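import Summits.QuantumFields.BalabanUV.T4Continuum.Spine.NE9.DirectPairingRunLimit

/-!
# T⁴ programme, spine estimate NE9 — KING'S CURRENCY, THE LAST UNIFORMITY IS LOAD-BEARING: the RUN TOWER — tower-NE5, prefix
# dependence, the bound, every PER-RUN modulus and the per-run factorisation through compact local data hold, yet the King-currency
# END fails, the carriers-level `hUC` fails at every weight, and the local functions do not stabilise in the run — census item C35
# (necessity half) of cell `pub-balaban-gaps`, seat ne9 (gen 8); companion of `DirectPairingRunLimit`

Cell `pub-balaban-gaps` (YM blitz G2, seat ne9, unit `pub-balaban-gaps-ne9-g8`; record `run/shared/lean/pub/pub-balaban-gaps/ne/NE9.md` §5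
row C35).  Summits-side bookkeeping; three WITNESS definitions (`runTower`, `runTerm`, `runEm` — the objects the theorems are about);
nothing of Bałaban's asserted.

WHAT IS PROVED.  THE RUN TOWER: domains `X = n ∈ ℕ`, domain `n` BORN IN RUN `n` (so at scale `m` it lives in run `n + m`, i.e. on a
torus of `L^n` sites a side), ONE shape of tree length `0`, one background; in run `k` the domain `n` carries `sin((n+1)·g_{k−n−1})` — a
function of its YOUNGEST coupling (age one), oscillating faster the later the domain is born — and `0` at scale `0`.
* §1 every hypothesis of `TowerCarriersKing.directBracket_eventually_le_carriers` EXCEPT the carriers-level `hUC` holds: `TowerNE5On` with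
  `C₅ = 1`, any `θ ≥ 0` (`towerNE5On_runTerm`: above scale `0` one more UV step changes nothing — the youngest coupling has the same AGE
  in both runs — and at scale `0` the difference is `|sin| ≤ 1 = C₅θ⁰`), prefix dependence (`prefix_runTerm`), the bound `B = 1` at every
  weight (`bound_runTerm`); and `hUC` holds RUN BY RUN (`perRun_sepUC_runTerm`: with the run quantifier outside, `δ = ε∕(k+1)`).
* §2 the END FAILS: for the profile `P_i = π∕(i+1) → 0` and `η = 1` no scale threshold works (`runTerm_not_directSmall`: given `M₀`, the
  domain `n = M₀` at scale `M₀ + 1`, gap `0`, and two admissible histories differing only in the youngest coupling by exactly `P_{M₀}`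
  give `sin(3π∕2) = −1` against `sin(π∕2) = 1`); hence the carriers-level `hUC` FAILS AT EVERY WEIGHT (`runTerm_not_sepUC`, by
  `directBracket_eventually_le_carriers` itself) although every per-run modulus holds — the uniformity over the RUNS at fixed scale is
  load-bearing for the END, not only for the lemma; tree length `0` makes the κ-loss of `DirectPairingLocality.sepUC_of_shapes` void, so
  (S)(B)(K) do not rescue it either.
* §3 at scale `1` the per-run local functions are `runEm k c u = sin(k·c₀)` on the one-point compact space of local data: jointly
  continuous for each run (`runEm_continuousOn`), the factorisation of `DirectPairingRunLimit.sepUCshape_of_stabilising` holds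
  (`runTerm_fac`) — and `runEm` does NOT stabilise (`runEm_not_stabilising`, by contraposition through `sepUCshape_of_stabilising`): with
  per-run continuity, compactness, locality, the bound and tower-NE5 all in force, stabilisation in the run is the one thing missing.

VERDICT FOR THE ROW (bookkeeping): the run-uniformity clause of C34∕C35 cannot be dropped; see `DirectPairingRunLimit` for the three
sufficient sources (exact locality ∕ stabilisation ∕ a volume-uniform quantitative modulus), each a property of W1's one-step object.
Classification of NE9 UNCHANGED in kind (WORK-bound on W1; instance 0∕1).

HONEST FRAMING: a toy witness on abstract carriers; nothing of Bałaban's construction is modelled; tower-NE5 ∕ NE9 NOT PRINTED ∕ NOT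
PROVED; spine PROVED 0∕9 unchanged; ONE FIXED finite four-torus; NOT UV stability, NOT the continuum limit, NOT infinite volume, NOT a
mass gap, NOT Clay.

References (TYPES only): [Balaban1987RG1] = T. Bałaban, Commun. Math. Phys. **109** (1987) 249–301, Thm 1 p. 259, p. 263; [King1986] =
C. King, Commun. Math. Phys. **102** (1986) 649–677, §3.2 pp. 656–657.
-/

namespace Summit.QuantumFields.BalabanUV.T4Continuum.NE9.DirectPairingRunLimitSharp

open scoped BigOperators
open Finset Filter Topology Metric Set
open Literature.MathematicalPhysics.QuantumFieldTheory.Balaban1983to89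
open Literature.MathematicalPhysics.QuantumFieldTheory.Balaban1983to89.T4OutputRate (NE5)
open Literature.MathematicalPhysics.QuantumFieldTheory.Balaban1983to89.T4CouplingAnalyticity (BoxWindow)
open Summit.QuantumFields.BalabanUV.T4Continuum.NE9.TowerCarriers
open Summit.QuantumFields.BalabanUV.T4Continuum.NE9.TowerCarriersBox (TowerNE5On)
open Summit.QuantumFields.BalabanUV.T4Continuum.NE9.TowerCarriersKing (directBracket_eventually_le_carriers)
open Summit.QuantumFields.BalabanUV.T4Continuum.NE9.DirectPairingRunLimit (sepUCshape_of_stabilising)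

/-! ## §1 The run tower: every hypothesis but the run-uniform modulus -/

/-- WITNESS DATA — THE RUN TOWER: domains `X = n ∈ ℕ`, domain `n` BORN IN RUN `n` (so at scale `m` it lives in run `n + m`, on a torus
that grows with `n`), ONE shape of tree length `0`, one background. [folklore] -/
def runTower : TowerData where
  Dom := ℕ
  r := fun n => n
  d := fun _ => 0
  d_nonneg := fun _ => le_rfl
  B := Unit
  gauge := fun _ _ => 0
  gauge_nonneg := fun _ _ => le_rfl
  tr := fun _ U => U

/-- WITNESS TERMS: in run `k` the domain `n` (scale `k − n`) carries `sin((n+1)·g_{k−n−1})` — a function of its YOUNGEST coupling (age one)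
only, oscillating faster the later the domain is born — and `0` at scale `0`. [folklore] -/
noncomputable def runTerm : ℕ → (ℕ → ℝ) → Unit → ℕ → ℝ :=
  fun k g _ n => if n < k then Real.sin ((n + 1) * g (k - n - 1)) else 0

/-- Above scale `0` the term reads the youngest coupling. [folklore] -/
theorem runTerm_of_lt {k n : ℕ} (h : n < k) (g : ℕ → ℝ) (U : Unit) :
    runTerm k g U n = Real.sin ((n + 1) * g (k - n - 1)) := by
  simp [runTerm, h]

/-- At scale `0` (and for unborn domains) the term vanishes. [folklore] -/
theorem runTerm_of_not_lt {k n : ℕ} (h : ¬ n < k) (g : ℕ → ℝ) (U : Unit) : runTerm k g U n = 0 := by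
  simp [runTerm, h]

/-- **TOWER-NE5 HOLDS** (`C₅ = 1`, any `θ ≥ 0`, any box, any weight): above scale `0` one more UV step changes nothing (the youngest coupling
has the same age in both runs), at scale `0` the difference is `|sin| ≤ 1 = C₅θ⁰`. [folklore] -/
theorem towerNE5On_runTerm (I : Set ℝ) (κ : ℝ) {θ : ℝ} (hθ : 0 ≤ θ) : TowerNE5On runTower runTerm I κ θ 1 := by
  intro k b _ g _ U n
  change ℕ at n
  show |runTerm k g U n - runTerm (k + 1) (prepend b g) U n| ≤ 1 * θ ^ (k - n) * Real.exp (-(κ * (0 : ℝ)))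
  rw [mul_zero, neg_zero, Real.exp_zero, mul_one, one_mul]
  by_cases h : n < k
  · rw [runTerm_of_lt h, runTerm_of_lt (by omega)]
    have e : prepend b g (k + 1 - n - 1) = g (k - n - 1) := by
      rw [show k + 1 - n - 1 = (k - n - 1) + 1 by omega, prepend_succ]
    rw [e, sub_self, abs_zero]
    exact pow_nonneg hθ _
  · rw [runTerm_of_not_lt h]
    by_cases h' : n < k + 1
    · rw [runTerm_of_lt h', zero_sub, abs_neg, show k - n = 0 by omega, pow_zero]
      exact Real.abs_sin_le_one _
    · rw [runTerm_of_not_lt h', sub_self, abs_zero]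
      exact pow_nonneg hθ _

/-- **PREFIX DEPENDENCE HOLDS**: the scale-`(k − n)` term reads only the coupling of index `k − n − 1 < k − n`. [folklore] -/
theorem prefix_runTerm (I : Set ℝ) :
    ∀ (k : ℕ) (U : runTower.B) (X : runTower.Dom), ∀ g ∈ BoxWindow I, ∀ g' ∈ BoxWindow I,
      (∀ i, i < k - runTower.r X → g i = g' i) → runTerm k g U X = runTerm k g' U X := by
  intro k U n g _ g' _ hagree
  change ℕ at n
  by_cases h : n < k
  · rw [runTerm_of_lt h, runTerm_of_lt h, hagree (k - n - 1) (by show k - n - 1 < k - n; omega)]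
  · rw [runTerm_of_not_lt h, runTerm_of_not_lt h]

/-- **THE BOUND HOLDS** with `B = 1` at every weight. [folklore] -/
theorem bound_runTerm (κ : ℝ) (I : Set ℝ) :
    ∀ (k : ℕ) (U : runTower.B) (X : runTower.Dom), ∀ g ∈ BoxWindow I,
      Real.exp (κ * runTower.d X) * |runTerm k g U X| ≤ 1 := by
  intro k U n g _
  change ℕ at n
  show Real.exp (κ * 0) * |runTerm k g U n| ≤ 1
  rw [mul_zero, Real.exp_zero, one_mul]
  by_cases h : n < k
  · rw [runTerm_of_lt h]; exact Real.abs_sin_le_one _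
  · rw [runTerm_of_not_lt h, abs_zero]; exact zero_le_one

/-- **EVERY PER-RUN MODULUS HOLDS**: with the run quantifier OUTSIDE, `δ = ε∕(k+1)` serves all domains of run `k` (their frequencies are
`≤ k`) — the per-run joint continuity gen 7's `sepUCshape_of_compact` would consume run by run. [folklore] -/
theorem perRun_sepUC_runTerm (κ : ℝ) (I : Set ℝ) :
    ∀ k m i : ℕ, i < m → ∀ ε : ℝ, 0 < ε → ∃ δ : ℝ, 0 < δ ∧ ∀ (U : runTower.B) (X : runTower.Dom), runTower.r X + m = k →
      ∀ g ∈ BoxWindow I, ∀ g' ∈ BoxWindow I, (∀ j, j ≠ i → g j = g' j) → |g i - g' i| ≤ δ →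
        Real.exp (κ * runTower.d X) * |runTerm k g U X - runTerm k g' U X| ≤ ε := by
  intro k m i hi ε hε
  refine ⟨ε / (k + 1), by positivity, fun U n hn g _ g' _ hagree hdiff => ?_⟩
  change ℕ at n
  change n + m = k at hn
  show Real.exp (κ * 0) * |runTerm k g U n - runTerm k g' U n| ≤ ε
  rw [mul_zero, Real.exp_zero, one_mul]
  have hnk : n < k := by omega
  rw [runTerm_of_lt hnk, runTerm_of_lt hnk]
  have hn1 : (0 : ℝ) < n + 1 := by positivity
  have hnk' : (n : ℝ) + 1 ≤ k + 1 := by exact_mod_cast Nat.succ_le_succ hnk.le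
  calc |Real.sin ((n + 1) * g (k - n - 1)) - Real.sin ((n + 1) * g' (k - n - 1))|
      ≤ |(n + 1) * g (k - n - 1) - (n + 1) * g' (k - n - 1)| := Real.abs_sin_sub_sin_le _ _
    _ = (n + 1) * |g (k - n - 1) - g' (k - n - 1)| := by rw [← mul_sub, abs_mul, abs_of_pos hn1]
    _ ≤ (n + 1) * (ε / (k + 1)) := by
        refine mul_le_mul_of_nonneg_left ?_ hn1.le
        by_cases hj : k - n - 1 = i
        · rw [hj]; exact hdiff
        · rw [hagree _ hj, sub_self, abs_zero]; positivity
    _ ≤ (k + 1) * (ε / (k + 1)) := mul_le_mul_of_nonneg_right hnk' (by positivity)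
    _ = ε := by field_simp

/-! ## §2 The END fails; the carriers-level `hUC` fails at every weight -/

/-- The two admissible values of the youngest coupling used below: `s = π∕(2(N+1))` and `s + π∕(N+1)`, both in `[0, 6]`, at which
`sin((N+1)·)` takes the values `1` and `−1`. [folklore] -/
theorem sin_pair (N : ℕ) :
    Real.sin ((N + 1) * (Real.pi / (2 * (N + 1)))) = 1 ∧
      Real.sin ((N + 1) * (Real.pi / (2 * (N + 1)) + Real.pi / (N + 1))) = -1 ∧
      (0 : ℝ) ≤ Real.pi / (2 * (N + 1)) ∧ Real.pi / (2 * (N + 1)) + Real.pi / (N + 1) ≤ 6 := by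
  have hπ : 0 < Real.pi := Real.pi_pos
  have hN : (0 : ℝ) < N + 1 := by positivity
  refine ⟨?_, ?_, by positivity, ?_⟩
  · rw [show ((N : ℝ) + 1) * (Real.pi / (2 * (N + 1))) = Real.pi / 2 by field_simp, Real.sin_pi_div_two]
  · rw [show ((N : ℝ) + 1) * (Real.pi / (2 * (N + 1)) + Real.pi / (N + 1)) = Real.pi / 2 + Real.pi by field_simp,
      Real.sin_add_pi, Real.sin_pi_div_two]
  · have hN0 : (0 : ℝ) ≤ N := Nat.cast_nonneg N
    have h1 : Real.pi / (2 * (N + 1)) ≤ Real.pi / 2 := by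
      rw [← div_div]
      exact div_le_self (by positivity) (by linarith)
    have h2 : Real.pi / (N + 1) ≤ Real.pi := div_le_self hπ.le (by linarith)
    linarith [Real.pi_le_four]

/-- **THE KING-CURRENCY END FAILS ON THE RUN TOWER**: for the profile `P_i = π∕(i+1) → 0` and `η = 1` there is NO scale threshold `M₀`
beyond which every direct bracket is `≤ η·e^{−κd}` — given `M₀`, the domain `n = M₀` at scale `M₀ + 1` (run `2M₀ + 1`, gap `0`) and
two histories differing only in the youngest coupling by exactly `P_{M₀} = π∕(M₀+1)` have terms `sin(π∕2) = 1` and `sin(3π∕2) = −1`.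
So the conclusion of `TowerCarriersKing.directBracket_eventually_le_carriers` is FALSE here although tower-NE5, prefix dependence, the
bound and every per-run modulus hold. [folklore] -/
theorem runTerm_not_directSmall (κ : ℝ) :
    ¬ (∀ η : ℝ, 0 < η → ∃ M₀ : ℕ, ∀ (k n : ℕ) (U : runTower.B) (X : runTower.Dom), runTower.r X + M₀ ≤ k →
        ∀ g ∈ BoxWindow (Icc (0 : ℝ) 6), ∀ g' ∈ BoxWindow (Icc (0 : ℝ) 6),
          (∀ i, i < k - runTower.r X → |g (i + n) - g' i| ≤ Real.pi / (i + 1)) →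
            |runTerm (k + n) g U X - runTerm k g' (runTower.descend (k + n) U k) X| ≤
              η * Real.exp (-(κ * runTower.d X))) := by
  intro h
  obtain ⟨M₀, hM⟩ := h 1 one_pos
  obtain ⟨s1, s2, hs0, hs5⟩ := sin_pair M₀
  have hπ : 0 < Real.pi := Real.pi_pos
  set s : ℝ := Real.pi / (2 * (M₀ + 1)) with hs
  -- run `k = 2M₀ + 1`, gap `0`, domain `n = M₀` (scale `M₀ + 1`), youngest coupling index `M₀`
  set g : ℕ → ℝ := fun j => if j = M₀ then s + Real.pi / (M₀ + 1) else 0 with hg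
  set g' : ℕ → ℝ := fun j => if j = M₀ then s else 0 with hg'
  have hq0 : (0 : ℝ) ≤ Real.pi / (M₀ + 1) := by positivity
  have hgM : g M₀ = s + Real.pi / (M₀ + 1) := if_pos rfl
  have hg'M : g' M₀ = s := if_pos rfl
  have hgj : ∀ j, j ≠ M₀ → g j = 0 := fun j hj => if_neg hj
  have hg'j : ∀ j, j ≠ M₀ → g' j = 0 := fun j hj => if_neg hj
  have h06 : (0 : ℝ) ∈ Icc (0 : ℝ) 6 := ⟨le_rfl, by norm_num⟩
  have hgm : g ∈ BoxWindow (Icc (0 : ℝ) 6) := fun j => by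
    by_cases hj : j = M₀
    · rw [hj, hgM]; exact ⟨add_nonneg hs0 hq0, hs5⟩
    · rw [hgj j hj]; exact h06
  have hg'm : g' ∈ BoxWindow (Icc (0 : ℝ) 6) := fun j => by
    by_cases hj : j = M₀
    · rw [hj, hg'M]; exact ⟨hs0, by linarith⟩
    · rw [hg'j j hj]; exact h06
  have key := hM (2 * M₀ + 1) 0 () M₀ (by show M₀ + M₀ ≤ 2 * M₀ + 1; omega) g hgm g' hg'm (fun i _ => by
    show |g (i + 0) - g' i| ≤ Real.pi / (i + 1)
    rw [add_zero]
    by_cases hi : i = M₀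
    · rw [hi, hgM, hg'M, add_sub_cancel_left, abs_of_nonneg hq0]
    · rw [hgj i hi, hg'j i hi, sub_self, abs_zero]; positivity)
  have hlt : M₀ < 2 * M₀ + 1 := by omega
  have e1 : runTerm (2 * M₀ + 1 + 0) g () M₀ = -1 := by
    rw [add_zero, runTerm_of_lt hlt, show 2 * M₀ + 1 - M₀ - 1 = M₀ by omega, hgM]
    exact s2
  have e2 : runTerm (2 * M₀ + 1) g' (runTower.descend (2 * M₀ + 1 + 0) () (2 * M₀ + 1)) M₀ = 1 := by
    rw [runTerm_of_lt hlt, show 2 * M₀ + 1 - M₀ - 1 = M₀ by omega, hg'M]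
    exact s1
  rw [e1, e2, show runTower.d M₀ = (0 : ℝ) from rfl, mul_zero, neg_zero, Real.exp_zero, mul_one] at key
  norm_num at key

/-- **HENCE THE CARRIERS-LEVEL `hUC` FAILS AT EVERY WEIGHT** on the run tower (else `TowerCarriersKing.directBracket_eventually_le_carriers`,
fed with `towerNE5On_runTerm` and `prefix_runTerm`, would give the END refuted by `runTerm_not_directSmall`) — while every PER-RUN modulus
holds (`perRun_sepUC_runTerm`): the uniformity over the runs at fixed scale is load-bearing. [folklore] -/
theorem runTerm_not_sepUC (κ : ℝ) :
    ¬ (∀ m i : ℕ, i < m → ∀ ε : ℝ, 0 < ε → ∃ δ : ℝ, 0 < δ ∧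
        ∀ (k : ℕ) (U : runTower.B) (X : runTower.Dom), runTower.r X + m = k →
          ∀ g ∈ BoxWindow (Icc (0 : ℝ) 6), ∀ g' ∈ BoxWindow (Icc (0 : ℝ) 6), (∀ j, j ≠ i → g j = g' j) → |g i - g' i| ≤ δ →
            Real.exp (κ * runTower.d X) * |runTerm k g U X - runTerm k g' U X| ≤ ε) := fun hUC =>
  runTerm_not_directSmall κ fun η hη =>
    directBracket_eventually_le_carriers runTower (P := fun i => Real.pi / (i + 1)) zero_le_one le_rfl zero_lt_one
      (towerNE5On_runTerm (Icc (0 : ℝ) 6) κ le_rfl) (prefix_runTerm _) hUC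
      (by
        have h := tendsto_one_div_add_atTop_nhds_zero_nat.const_mul Real.pi
        rw [mul_zero] at h
        exact h.congr fun i => by ring) hη

/-! ## §3 The per-run local functions do not stabilise -/

/-- THE PER-RUN LOCAL FUNCTIONS at scale `1`: in run `k` the scale-`1` domain is `n = k − 1` and its normalised term is `sin(k·g₀)` —
`runEm k c u = sin(k·c₀)`, jointly continuous for each `k`, on the one-point compact space of local data. [folklore] -/
noncomputable def runEm : ℕ → (Fin 1 → ℝ) → Unit → ℝ := fun k c _ => Real.sin (k * c 0)

/-- Each `runEm k` is jointly continuous (on any set). [folklore] -/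
theorem runEm_continuousOn (k : ℕ) (S : Set ((Fin 1 → ℝ) × Unit)) :
    ContinuousOn (fun p : (Fin 1 → ℝ) × Unit => runEm k p.1 p.2) S := by
  apply Continuous.continuousOn
  unfold runEm
  fun_prop

/-- The factorisation hypothesis of `sepUCshape_of_stabilising` at scale `1` for the run tower: local datum `()` in the compact `univ`,
normalised term `= runEm k (g|_{<1}) ()`. [folklore] -/
theorem runTerm_fac (κ : ℝ) (J : Set ℝ) :
    ∀ (k : ℕ) (U : runTower.B) (X : runTower.Dom), (fun _ : runTower.Dom => ()) X = () → runTower.r X + 1 = k →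
      (fun (_ : ℕ) (_ : runTower.B) (_ : runTower.Dom) => ()) k U X ∈ (Set.univ : Set Unit) ∧
        ∀ g ∈ BoxWindow J, Real.exp (κ * runTower.d X) * runTerm k g U X = runEm k (fun l => g l) () := by
  intro k U n _ hn
  change ℕ at n
  change n + 1 = k at hn
  refine ⟨Set.mem_univ _, fun g _ => ?_⟩
  show Real.exp (κ * 0) * runTerm k g U n = Real.sin (k * g ((0 : Fin 1) : ℕ))
  rw [mul_zero, Real.exp_zero, one_mul, runTerm_of_lt (by omega), show k - n - 1 = 0 by omega]
  subst hn
  simp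

/-- **AND `runEm` DOES NOT STABILISE**: every other hypothesis of `sepUCshape_of_stabilising` holds at scale `1` on the run tower (compact
local data `univ : Set Unit`, per-run joint continuity `runEm_continuousOn`, factorisation `runTerm_fac`, box `[0, 6]`), and its conclusion
at coordinate `0` is refuted inside `runTerm_not_sepUC`'s argument (scale `1` suffices: `M₀ = 0` there) — so stabilisation fails; directly:
`|sin(k·c₀) − sin(K₀·c₀)|` does not become uniformly small.  Proved by contraposition through §2. [folklore] -/
theorem runEm_not_stabilising :
    ¬ (∀ ε : ℝ, 0 < ε → ∃ K₀ : ℕ, ∀ k, K₀ ≤ k →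
        ∀ p ∈ (Set.univ.pi fun _ : Fin 1 => Icc (0 : ℝ) 6) ×ˢ (Set.univ : Set Unit), |runEm k p.1 p.2 - runEm K₀ p.1 p.2| ≤ ε) := by
  intro hstab
  have h := sepUCshape_of_stabilising runTower (κ := 0) (fun _ => ()) () 1 isCompact_univ (subset_refl (Icc (0 : ℝ) 6)) runEm
    (fun k => runEm_continuousOn k _) hstab (fun _ _ _ => ()) (runTerm_fac 0 (Icc (0 : ℝ) 6)) 0 1 one_pos
  obtain ⟨δ, hδ, hδ'⟩ := h
  -- a run `k = n + 1` with `π / (n + 1) ≤ δ`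
  obtain ⟨n, hn⟩ := exists_nat_ge (Real.pi / δ)
  obtain ⟨s1, s2, hs0, hs5⟩ := sin_pair n
  have hπ : 0 < Real.pi := Real.pi_pos
  have hn1 : (0 : ℝ) < n + 1 := by positivity
  have hstep : Real.pi / (n + 1) ≤ δ := by
    rw [div_le_iff₀ hn1]
    have h1 : Real.pi / δ * δ = Real.pi := div_mul_cancel₀ _ hδ.ne'
    nlinarith [mul_le_mul_of_nonneg_right hn hδ.le]
  set s : ℝ := Real.pi / (2 * (n + 1)) with hs
  set g : ℕ → ℝ := fun j => if j = 0 then s + Real.pi / (n + 1) else 0 with hg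
  set g' : ℕ → ℝ := fun j => if j = 0 then s else 0 with hg'
  have hq0 : (0 : ℝ) ≤ Real.pi / (n + 1) := by positivity
  have hgM : g 0 = s + Real.pi / (n + 1) := if_pos rfl
  have hg'M : g' 0 = s := if_pos rfl
  have hgj : ∀ j, j ≠ 0 → g j = 0 := fun j hj => if_neg hj
  have hg'j : ∀ j, j ≠ 0 → g' j = 0 := fun j hj => if_neg hj
  have h06 : (0 : ℝ) ∈ Icc (0 : ℝ) 6 := ⟨le_rfl, by norm_num⟩
  have hgm : g ∈ BoxWindow (Icc (0 : ℝ) 6) := fun j => by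
    by_cases hj : j = 0
    · rw [hj, hgM]; exact ⟨add_nonneg hs0 hq0, hs5⟩
    · rw [hgj j hj]; exact h06
  have hg'm : g' ∈ BoxWindow (Icc (0 : ℝ) 6) := fun j => by
    by_cases hj : j = 0
    · rw [hj, hg'M]; exact ⟨hs0, by linarith⟩
    · rw [hg'j j hj]; exact h06
  have key := hδ' (n + 1) () n rfl rfl g hgm g' hg'm (fun j hj => by rw [hgj j hj, hg'j j hj])
    (by rw [hgM, hg'M, add_sub_cancel_left, abs_of_nonneg hq0]; exact hstep)
  have hlt : n < n + 1 := Nat.lt_succ_self n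
  rw [show runTower.d n = (0 : ℝ) from rfl, mul_zero, Real.exp_zero, one_mul, runTerm_of_lt hlt, runTerm_of_lt hlt,
    show n + 1 - n - 1 = 0 by omega, hgM, hg'M, s2, s1] at key
  norm_num at key

end Summit.QuantumFields.BalabanUV.T4Continuum.NE9.DirectPairingRunLimitSharp
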